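import Mathlib
import Literature.Computability.Complexity.RangeAvoidance
import Literature.Computability.Complexity.SignDegreeXor
import Summits.PneNP.PneNP.Theorems.PstarIsolation
import Summits.PneNP.PneNP.Theorems.PstarIsolationBound

/-!
# Worst-case all-ones isolation FAILS for pure `P⋆` maps at every stretch (cell `pnp-ideate`, ROUND-19/20, question T3)

FRONTIER range-avoidance ladder, structured side of rung F-N3 (restricted-model algorithmics — nothing here bears on
`P` vs `NP`).  ROUND-19 §4 asked (T3) whether every pure `P⋆ = x_a ⊕ x_b ⊕ x_c·x_d` instance with `m ≥ C·n` has SOME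
output `i` whose neighbour `1ᵐ ⊕ e_i` of the all-ones range point lies outside the range (worst-case form of the
isolation theorem `PstarIsolationBound.isolationTheorem`).  The answer is NO, at every linear stretch and indeed up to
`m ≈ n²/4`: the HUB INSTANCE `hub k` on `n = 2k+2` variables with `m = k²` outputs `y_{(c,d)} = x_{2k} ⊕ x_{2k+1} ⊕ x_c·x_{k+d}`
(`c, d < k`; one shared XOR pair, a complete bipartite set of AND pairs) has EVERY neighbour of `1ᵐ` in its range — the
private violator of output `(c,d)` is `x = 1_{ {2k, c, k+d} }` (`hub_onesFlip_mem_range`).  Hence `¬ WorstCaseAllOnesIsolation`.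
Structural reading: the instance is TYPED (XOR variables and AND variables disjoint) with BIPARTITE XOR graph; for such
instances `Range = colspace(M_L) ⊕ AND-range ∋ 1ᵐ ⊕ e_i`, and the promise `PseudoRandom` fails through the missing
lower discrepancy of `eL` (no XOR edge inside the complement of the hub).  So a worst-case algorithm must leave the base
point `1ⁿ` (base-point freedom, ROUND-20 S2) or treat typed/bipartite structure separately.
-/

set_option linter.dupNamespace false

open Literature.Computability.Complexity
open Summit.PneNP.PneNP.Theorems.PstarIsolation
open Summit.PneNP.PneNP.Theorems.PstarIsolationBound (AllOnesIsolated)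

namespace Summit.PneNP.PneNP.Theorems.PstarIsolationWorstCase

/-- **T3 as a Prop**: worst-case isolation of the all-ones range point at some linear stretch. (FALSE — see below.) -/
def WorstCaseAllOnesIsolation : Prop :=
  ∃ C : ℕ, ∀ (n m : ℕ) (I : LocalMap 4 n m), I.IsPure xorAndPred → 0 < n → C * n ≤ m → AllOnesIsolated I

/-- The XOR-column index of output `j` of the hub instance. -/
def cIdx {k : ℕ} (j : Fin (k * k)) : Fin k := (finProdFinEquiv.symm j).1
/-- The AND-row index of output `j` of the hub instance. -/
def dIdx {k : ℕ} (j : Fin (k * k)) : Fin k := (finProdFinEquiv.symm j).2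

/-- An output is determined by its two indices. -/
theorem cIdx_dIdx_inj {k : ℕ} {i j : Fin (k * k)} (hc : cIdx j = cIdx i) (hd : dIdx j = dIdx i) : j = i := by
  apply finProdFinEquiv.symm.injective
  exact Prod.ext hc hd

/-- The positions read by output `j = (c,d)`: `2k, 2k+1 | c, k+d`. -/
def hubVars (k : ℕ) (j : Fin (k * k)) : Fin 4 → Fin (2 * k + 2) :=
  ![⟨2 * k, by omega⟩, ⟨2 * k + 1, by omega⟩,
    ⟨(cIdx j).val, by have := (cIdx j).isLt; omega⟩,
    ⟨k + (dIdx j).val, by have := (dIdx j).isLt; omega⟩]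

/-- **The hub instance** `hub k : {0,1}^{2k+2} → {0,1}^{k²}`, `y_{(c,d)} = x_{2k} ⊕ x_{2k+1} ⊕ x_c · x_{k+d}`. -/
def hub (k : ℕ) : LocalMap 4 (2 * k + 2) (k * k) where
  vars := hubVars k
  table := fun _ => xorAndPred

/-- The hub instance is a pure `P⋆` instance (four distinct positions per output). -/
theorem hub_isPure (k : ℕ) : (hub k).IsPure xorAndPred := by
  refine ⟨fun _ => rfl, fun j => ?_⟩
  have h1 := (cIdx j).isLt
  have h2 := (dIdx j).isLt
  intro p q h
  fin_cases p <;> fin_cases q <;> simp [hub, hubVars, Fin.ext_iff] at h ⊢ <;> omega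

/-- The private violator of output `i = (c,d)`: ones exactly at `2k`, `c`, `k+d`. -/
def hubWitness (k : ℕ) (i : Fin (k * k)) : Fin (2 * k + 2) → Bool :=
  fun v => decide (v.val = 2 * k ∨ v.val = (cIdx i).val ∨ v.val = k + (dIdx i).val)

/-- The value of output `j` at the private violator of output `i`: `0` iff `j = i`. -/
theorem hub_eval (k : ℕ) (i j : Fin (k * k)) :
    (hub k).eval (hubWitness k i) j = !(decide (cIdx j = cIdx i) && decide (dIdx j = dIdx i)) := by
  have h1 := (cIdx j).isLt
  have h2 := (dIdx j).isLt
  have h3 := (cIdx i).isLt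
  have h4 := (dIdx i).isLt
  have e0 : hubWitness k i (hubVars k j 0) = true := by simp [hubWitness, hubVars]
  have e1 : hubWitness k i (hubVars k j 1) = false := by
    have hv : (hubVars k j 1).val = 2 * k + 1 := rfl
    simp only [hubWitness, hv, decide_eq_false_iff_not]
    omega
  have e2 : hubWitness k i (hubVars k j 2) = decide (cIdx j = cIdx i) := by
    simp only [hubWitness, hubVars, Matrix.cons_val_two, Matrix.tail_cons, Matrix.head_cons, Fin.ext_iff]
    by_cases h : (cIdx j).val = (cIdx i).val <;> simp [h]
    omega
  have e3 : hubWitness k i (hubVars k j 3) = decide (dIdx j = dIdx i) := by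
    simp only [hubWitness, hubVars, Matrix.cons_val_three, Matrix.tail_cons, Matrix.head_cons, Fin.ext_iff]
    by_cases h : (dIdx j).val = (dIdx i).val <;> simp [h]
    omega
  show xorAndPred (fun s => hubWitness k i (hubVars k j s)) = _
  rw [xorAndPred_apply, e0, e1, e2, e3]
  cases decide (cIdx j = cIdx i) <;> cases decide (dIdx j = dIdx i) <;> rfl

/-- **Every neighbour of `1ᵐ` is in the range of the hub instance.** -/
theorem hub_onesFlip_mem_range (k : ℕ) (i : Fin (k * k)) : onesFlip i ∈ (hub k).range := by
  refine ⟨hubWitness k i, funext fun j => ?_⟩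
  rw [hub_eval]
  by_cases hj : j = i
  · subst hj
    simp [(onesFlip_eq_false_iff j j).2 rfl]
  · have hne : onesFlip i j ≠ false := fun h => hj ((onesFlip_eq_false_iff i j).1 h)
    have ht : onesFlip i j = true := by
      cases h : onesFlip i j with
      | false => exact absurd h hne
      | true => rfl
    rw [ht]
    by_cases hc : cIdx j = cIdx i
    · by_cases hd : dIdx j = dIdx i
      · exact absurd (cIdx_dIdx_inj hc hd) hj
      · simp [hd]
    · simp [hc]

/-- The hub instance is never all-ones-isolated (for `k ≥ 1`). -/
theorem hub_not_isolated (k : ℕ) (hk : 0 < k) : ¬ AllOnesIsolated (hub k) := by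
  intro h
  exact h ⟨0, Nat.mul_pos hk hk⟩ (hub_onesFlip_mem_range k _)

/-- **T3 is false**: there is no stretch `C` at which every pure `P⋆` instance with `m ≥ C·n` has an isolated direction at
the all-ones point (take `hub (2C+2)`: `n = 4C+6`, `m = (2C+2)² ≥ C·n`). -/
theorem not_worstCaseAllOnesIsolation : ¬ WorstCaseAllOnesIsolation := by
  rintro ⟨C, hC⟩
  have hmn : C * (2 * (2 * C + 2) + 2) ≤ (2 * C + 2) * (2 * C + 2) := by nlinarith
  exact hub_not_isolated (2 * C + 2) (by omega)
    (hC (2 * (2 * C + 2) + 2) ((2 * C + 2) * (2 * C + 2)) (hub (2 * C + 2)) (hub_isPure _) (by omega) hmn)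

end Summit.PneNP.PneNP.Theorems.PstarIsolationWorstCase
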